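import Summits.ResolutionOfSingularities.ResolutionOfSingularities.Theorems.HilbertSamuelEliminationSigmaMaxModificationsCorridor3WLadderIsoTailsHSArcRsop
import Summits.ResolutionOfSingularities.ResolutionOfSingularities.Theorems.HilbertSamuelEliminationSigmaMaxModificationsCorridor3WLadderGradeOneUnits
import Summits.ResolutionOfSingularities.ResolutionOfSingularities.Theorems.HilbertSamuelEliminationSigmaMaxModificationsCorridor3WLadderIsoTailsArcTranslated
import Literature.AlgebraicGeometry.Resolution.AdicQuotient
import Literature.AlgebraicGeometry.Resolution.CompletionBaseChange
import Literature.AlgebraicGeometry.Resolution.AdicCompletionRegular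
import Literature.AlgebraicGeometry.Resolution.PowerSeriesRegularLocal
import HarnessLib

/-!
# [OURS · L1 W4.2] D14 ROUTE H — the H7∞ SOCKET: H7 read in the completion, in the currency of H8

Cell res-hironaka, rung L, slot W4.2 (crux `SigmaMaxModificationsCorridor3`, stmt-ResolutionOfSingularities-19249); row
`stub_Wtop3M_pointed`, KERNEL K1 `IsoFreeRationalTailsImpossible`, res-L1-w42-lead-1's D14 BRIDGE CUT, ROUTE H. This file is
the glue between three dealt objects:

* H6(c)(d) (lead-1): Cohen coordinates `Ψ : κ⟦X₀, …, X_d⟧ ≃+* R̂` on the completion `R̂` of the regular local ring `R`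
  (`𝒪_{X_{n₀},x_{n₀}} ≅ R/(h)`, H4) in which the strict transforms straighten, with output «`h ∈ (ŷ − Σ_k c_k t^k)^m R̂`»;
* H7 (res-type-001, `…IsoTailsHSArc(Rsop).lean`): for ANY regular local `R'` of dimension `d+1` with a regular system of
  parameters `x = (x₀, …, x_d)`, `h ∈ (x₁, …, x_d)^m ∖ 𝔪^{m+1}`, `m ≥ 1`: the closed point of `Spec R'/(h)` is not isolated
  in the Hilbert–Samuel locus (levels `N ≥ d`);
* H8 (res-D-pv-010): isolation in the Hilbert–Samuel locus transfers from `Spec A` to `Spec Â`,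
  `Â = AdicCompletion (maximalIdeal A) A`.

Content (all PROVED, no new definitions):

* §1 r.s.p. algebra: `span_range_eq_maximalIdeal_of_mem_sup_sq` (Nakayama: elements of `𝔪` generating `𝔪` modulo `𝔪²`
  generate `𝔪`), `span_range_cons_sub_eq_maximalIdeal` (a regular system of parameters `(x₀, x₁, …, x_d)` stays one after
  translating the tail coordinates by elements of `(x₀) + 𝔪²`, e.g. `ŷ_k − Σ_{j≥1} c_{kj} t^j`), `span_range_comp_ringEquiv`
  (transport along `Ψ`), and `span_range_X_eq_maximalIdeal` (`(X₀, …, X_d) = 𝔪` in `κ⟦X⟧`, tree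
  `maximalIdeal_mvPowerSeries_eq_span`).
* §2 `mem_maximalIdeal_pow_iff_algebraMap_adicCompletion` — `a ∈ 𝔪ⁿ ↔ a ∈ 𝔪̂ⁿ` (`R/𝔪ⁿ ≅ R̂/𝔪̂ⁿ`, tree
  `quotientMap_pow_bijective_adicCompletion`), so `ord_𝔪 h` is read in `R̂`.
* §3 `nonempty_ringEquiv_adicCompletion_quotient_span` — from `e : A ≃+* R/(h)`:
  `Â ≃+* R̂ ⧸ (h)` (tree `adicCompletionCongr`, `quotientCompletionEquiv`, Matsumura Thm. 8.11).
* §4 ASSEMBLY `not_isIsolatedInHSMaxLocus_adicCompletion_of_translatedArc`: `R` regular local of dimension `d + 1`,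
  `e : A ≃+* R/(h)`, `1 ≤ m`, `h ∉ 𝔪_R^{m+1}`, `x̂` a regular system of parameters of `R̂` with `h ∈ (x̂₁, …, x̂_d)^m R̂`,
  `d ≤ N` ⟹ `¬ IsIsolatedInHSMaxLocus (Spec Â) N (closedPoint Â)` — verbatim the negation of H8's conclusion — and the
  Cohen-coordinate corollary `…_of_cohenTranslatedArc` taking `Ψ`, translations `c k ∈ (X₀) + 𝔪²` and
  `h ∈ (Ψ (X_{k+1} − c_k))_k^m`, which is the output shape of H6(c)(d). So `H∞ = H8 ∘ (this file) ∘ H6`.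
* §5 the same two sockets in the currency of H4 (res-type-071, `…IsoTailsEmbeddedStepStalk.exists_stalk_presentation`):
  a SURJECTION `σ : R ↠ A` with `ker σ = (h)` and `emb.dim R = d + 1` instead of `e : A ≃+* R/(h)` and `dim R = d + 1`.
* §6 `not_isIsolatedInHSMaxLocus_adicCompletion_of_frameTowerArc` — the plug in the EXACT output shape of lead-1's
  `FormalFrame.mem_pow_of_frameTower` (p524558): `ψ₀ h ∈ (X 1 − tSeries c₁, X 2 − tSeries c₂, X 3 − tSeries c₃)^m` for the base frame
  `ψ₀ = Ψ⁻¹ ∘ (R → R̂)`, `emb.dim R = 4`, `N ≥ 3` (uses `tSeries_mem_span_X_zero`: `Σ_{k≥1} f_k t^k ∈ (t)`).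

[OURS · L1 W4.2] bookkeeping; NOT a statement of any source, and NOT a statement of H. Hironaka's 2017 manuscript. AI-written
(res-type-001 g8); AI review is weaker than expert review.
-/

set_option linter.dupNamespace false

noncomputable section

open CategoryTheory AlgebraicGeometry TopologicalSpace IsLocalRing
open Literature.AlgebraicGeometry.Resolution Literature.RingTheory.HilbertSamuel
open Literature.AlgebraicGeometry.CossartJannsenSaito2020

namespace Summit.ResolutionOfSingularities.ResolutionOfSingularities.Theorems.SigmaMaxModificationsCorridor3.IsoTailsHS

universe u

/-! ## §1 Regular systems of parameters: Nakayama, translation, transport -/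

/-- **Nakayama for systems of parameters**: in a Noetherian local ring, elements of `𝔪` which generate `𝔪` modulo `𝔪²`
generate `𝔪`. [cite: Matsumura1987, Thm. 2.3 and §14 p. 104] -/
theorem span_range_eq_maximalIdeal_of_mem_sup_sq {R : Type u} [CommRing R] [IsLocalRing R] [IsNoetherianRing R]
    {ι : Type*} (x' : ι → R) (hx' : ∀ i, x' i ∈ maximalIdeal R)
    (hgen : maximalIdeal R ≤ Ideal.span (Set.range x') ⊔ maximalIdeal R ^ 2) :
    Ideal.span (Set.range x') = maximalIdeal R := by
  refine le_antisymm (Ideal.span_le.mpr (by rintro _ ⟨i, rfl⟩; exact hx' i)) ?_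
  refine Submodule.le_of_le_smul_of_le_jacobson_bot (maximalIdeal R).fg_of_isNoetherianRing
    (IsLocalRing.maximalIdeal_le_jacobson ⊥) ?_
  rwa [Ideal.smul_eq_mul, ← pow_two]

/-- **Translating the tail of a regular system of parameters**: if `(x₀, x₁, …, x_d)` generates `𝔪` and
`c_k ∈ (x₀) + 𝔪²` (`k = 1, …, d`), then `(x₀, x₁ − c₁, …, x_d − c_d)` generates `𝔪` — the form in which the Cohen coordinates
`(t, ŷ₁ − Σ_{j≥1} c_{1j} t^j, …)` of the D14 bridge cut are again a regular system of parameters. [folklore] -/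
theorem span_range_cons_sub_eq_maximalIdeal {R : Type u} [CommRing R] [IsLocalRing R] [IsNoetherianRing R] {d : ℕ}
    (x : Fin (d + 1) → R) (hx : Ideal.span (Set.range x) = maximalIdeal R) (c : Fin d → R)
    (hc : ∀ k, c k ∈ Ideal.span {x 0} ⊔ maximalIdeal R ^ 2) :
    Ideal.span (Set.range (Fin.cons (x 0) (fun k => x k.succ - c k) : Fin (d + 1) → R)) = maximalIdeal R := by
  set x' : Fin (d + 1) → R := Fin.cons (x 0) (fun k => x k.succ - c k) with hx'def
  have hxm : ∀ i, x i ∈ maximalIdeal R := fun i => hx ▸ Ideal.subset_span ⟨i, rfl⟩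
  have hx0 : x 0 ∈ Ideal.span (Set.range x') := Ideal.subset_span ⟨0, by simp [hx'def]⟩
  have hsq : maximalIdeal R ^ 2 ≤ maximalIdeal R := Ideal.pow_le_self two_ne_zero
  have hcm : ∀ k, c k ∈ maximalIdeal R := fun k =>
    (sup_le ((Ideal.span_singleton_le_iff_mem _).mpr (hxm 0)) hsq) (hc k)
  refine span_range_eq_maximalIdeal_of_mem_sup_sq x' (fun i => ?_) ?_
  · refine Fin.cases ?_ (fun k => ?_) i
    · simpa [hx'def] using hxm 0
    · simpa [hx'def] using Ideal.sub_mem _ (hxm k.succ) (hcm k)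
  · have hle : Ideal.span (Set.range x) ≤ Ideal.span (Set.range x') ⊔ maximalIdeal R ^ 2 := by
      rw [Ideal.span_le]
      rintro _ ⟨i, rfl⟩
      refine Fin.cases ?_ (fun k => ?_) i
      · exact Ideal.mem_sup_left hx0
      · have hk : x k.succ = x' k.succ + c k := by simp [hx'def]
        rw [hk]
        refine Ideal.add_mem _ (Ideal.mem_sup_left (Ideal.subset_span ⟨k.succ, rfl⟩)) ?_
        exact (sup_le_sup_right ((Ideal.span_singleton_le_iff_mem _).mpr hx0) _) (hc k)
    calc maximalIdeal R = Ideal.span (Set.range x) := hx.symm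
      _ ≤ _ := hle

/-- The tail of the translated system is the translated tail (`Fin.cons x₀ f ∘ Fin.succ = f`). [folklore] -/
theorem cons_comp_succ {R : Type u} {d : ℕ} (a : R) (f : Fin d → R) :
    (Fin.cons a f : Fin (d + 1) → R) ∘ Fin.succ = f := by
  funext k; simp

/-- **Transport of a system of generators of `𝔪` along a ring isomorphism** (e.g. the Cohen coordinates
`Ψ : κ⟦X⟧ ≃+* R̂`). [folklore] -/
theorem span_range_comp_ringEquiv {S R : Type u} [CommRing S] [CommRing R] [IsLocalRing S] [IsLocalRing R]
    (Ψ : S ≃+* R) {ι : Type*} (x : ι → S) (hx : Ideal.span (Set.range x) = maximalIdeal S) :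
    Ideal.span (Set.range (Ψ ∘ x)) = maximalIdeal R := by
  rw [Set.range_comp, ← map_ringEquiv_maximalIdeal Ψ, ← hx, Ideal.map_span]

/-- `(X₀, …, X_d) = 𝔪` in `κ⟦X₀, …, X_d⟧` (tree `maximalIdeal_mvPowerSeries_eq_span`). [folklore] -/
theorem span_range_X_eq_maximalIdeal (κ : Type u) [Field κ] (d : ℕ) :
    Ideal.span (Set.range (MvPowerSeries.X : Fin (d + 1) → MvPowerSeries (Fin (d + 1)) κ)) =
      maximalIdeal (MvPowerSeries (Fin (d + 1)) κ) :=
  (maximalIdeal_mvPowerSeries_eq_span κ (Fin (d + 1))).symm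

/-! ## §2 The `𝔪`-adic order is read in the completion -/

/-- **`a ∈ 𝔪ⁿ ↔ a ∈ 𝔪̂ⁿ`** for a Noetherian local ring `R` and its completion `R̂` (`R/𝔪ⁿ ≅ R̂/𝔪̂ⁿ`, `𝔪̂ = 𝔪R̂`).
[cite: Matsumura1987, Thm. 8.10 and Thm. 8.11] [cite: StacksProject, Tag 05GG] -/
theorem mem_maximalIdeal_pow_iff_algebraMap_adicCompletion {R : Type u} [CommRing R] [IsLocalRing R]
    [IsNoetherianRing R] (n : ℕ) (a : R) :
    a ∈ maximalIdeal R ^ n ↔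
      algebraMap R (AdicCompletion (maximalIdeal R) R) a ∈ maximalIdeal (AdicCompletion (maximalIdeal R) R) ^ n := by
  rw [AdicCompletion.maximalIdeal_eq_map, ← Ideal.map_pow]
  refine ⟨fun h => Ideal.mem_map_of_mem _ h, fun h => ?_⟩
  exact (quotientMap_injective_iff_forall _ _).mp
    (quotientMap_pow_bijective_adicCompletion (maximalIdeal R) (maximalIdeal R).fg_of_isNoetherianRing n).1 a h

/-! ## §3 `Â ≅ R̂/(h)` from `A ≅ R/(h)` -/

/-- **Completion commutes with the quotient by `h`**: from `e : A ≃+* R/(h)` (`R` Noetherian local, `A` local),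
`Â ≃+* R̂ ⧸ (h)R̂` for the `𝔪`-adic completions. [cite: Matsumura1987, Thm. 8.11] -/
theorem nonempty_ringEquiv_adicCompletion_quotient_span {R : Type u} [CommRing R] [IsLocalRing R] [IsNoetherianRing R]
    {A : Type u} [CommRing A] [IsLocalRing A] (h : R) [IsLocalRing (R ⧸ Ideal.span {h})]
    (e : A ≃+* R ⧸ Ideal.span {h}) :
    Nonempty (AdicCompletion (maximalIdeal A) A ≃+*
      AdicCompletion (maximalIdeal R) R ⧸
        Ideal.span {algebraMap R (AdicCompletion (maximalIdeal R) R) h}) := by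
  -- `Â ≅ (R/(h))^` along `e`
  let E₁ : AdicCompletion (maximalIdeal A) A ≃+*
      AdicCompletion (maximalIdeal (R ⧸ Ideal.span {h})) (R ⧸ Ideal.span {h}) :=
    adicCompletionCongr _ _ e (map_ringEquiv_maximalIdeal e)
  -- `(R/(h))^` at `𝔪_{R/(h)}` is `(R/(h))^` at `𝔪_R (R/(h))`
  have hm : (maximalIdeal R).map (Ideal.Quotient.mk (Ideal.span {h})) = maximalIdeal (R ⧸ Ideal.span {h}) :=
    IsLocalRing.map_maximalIdeal_of_surjective _ Ideal.Quotient.mk_surjective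
  let E₂ : AdicCompletion (maximalIdeal (R ⧸ Ideal.span {h})) (R ⧸ Ideal.span {h}) ≃+*
      AdicCompletion ((maximalIdeal R).map (Ideal.Quotient.mk (Ideal.span {h}))) (R ⧸ Ideal.span {h}) :=
    adicCompletionCongr _ _ (RingEquiv.refl _) (by rw [hm]; exact Ideal.map_id _)
  -- `(R/(h))^ ≅ R̂/(h)R̂` (Matsumura 8.11)
  let E₃ := (quotientCompletionEquiv (maximalIdeal R) (Ideal.span {h})).symm
  have hmap : (Ideal.span {h}).map (algebraMap R (AdicCompletion (maximalIdeal R) R)) =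
      Ideal.span {algebraMap R (AdicCompletion (maximalIdeal R) R) h} := by
    rw [Ideal.map_span, Set.image_singleton]
  exact ⟨(E₁.trans E₂).trans (E₃.trans (Ideal.quotEquivOfEq hmap))⟩

/-! ## §4 Assembly: H7 in the completion, in the currency of H8 -/

/-- **H7∞ SOCKET (D14 ROUTE H).** Let `R` be a regular local ring of dimension `d + 1`, `A` a local ring with
`e : A ≃+* R/(h)` (the hypersurface stage `𝒪_{X_{n₀},x_{n₀}}`, H4), `m ≥ 1` with `h ∉ 𝔪_R^{m+1}`, and let
`x̂ = (x̂₀, …, x̂_d)` generate the maximal ideal of the completion `R̂` with `h ∈ (x̂₁, …, x̂_d)^m R̂` (the straightened arc of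
H6). Then the closed point of `Spec Â`, `Â = AdicCompletion (maximalIdeal A) A`, is NOT isolated in the Hilbert–Samuel locus at
any level `N ≥ d` — the negation of the conclusion of H8 («isolation transfers to the completion»), so that an isolated
hypersurface stage admits no such arc. Proof: `R̂` is regular local of dimension `d + 1` (Matsumura §19), `h ∉ 𝔪̂^{m+1}` (§2),
H7 in r.s.p. form on `R̂` (`not_isIsolatedInHSMaxLocus_closedPoint_of_rsop_arc`), transported along `Â ≅ R̂/(h)` (§3).
[OURS · L1 W4.2; AI-written] [cite: CossartJannsenSaito2020, Def. 13.3] -/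
theorem not_isIsolatedInHSMaxLocus_adicCompletion_of_translatedArc {R : Type u} [CommRing R] [IsRegularLocalRing R]
    {d : ℕ} (hd : ringKrullDim R = (d + 1 : ℕ)) {A : Type u} [CommRing A] [IsLocalRing A] [IsNoetherianRing A]
    {h : R} (e : A ≃+* R ⧸ Ideal.span {h}) {m : ℕ} (hm : 1 ≤ m) (hh : h ∉ maximalIdeal R ^ (m + 1))
    (x : Fin (d + 1) → AdicCompletion (maximalIdeal R) R)
    (hx : Ideal.span (Set.range x) = maximalIdeal (AdicCompletion (maximalIdeal R) R))
    (hhP : algebraMap R (AdicCompletion (maximalIdeal R) R) h ∈ Ideal.span (Set.range (x ∘ Fin.succ)) ^ m)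
    {N : ℕ} (hN : d ≤ N) :
    ¬ IsIsolatedInHSMaxLocus (Spec (CommRingCat.of (AdicCompletion (maximalIdeal A) A))) N
        (closedPoint (AdicCompletion (maximalIdeal A) A)) := by
  haveI : IsRegularLocalRing (AdicCompletion (maximalIdeal R) R) := isRegularLocalRing_adicCompletion R
  have hd' : ringKrullDim (AdicCompletion (maximalIdeal R) R) = (d + 1 : ℕ) :=
    (ringKrullDim_adicCompletion R).trans hd
  have hh2 : algebraMap R (AdicCompletion (maximalIdeal R) R) h ∉
      maximalIdeal (AdicCompletion (maximalIdeal R) R) ^ (m + 1) := fun H =>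
    hh ((mem_maximalIdeal_pow_iff_algebraMap_adicCompletion (m + 1) h).mpr H)
  -- `R̂/(h)` and `R/(h)` are local (`h ∈ 𝔪̂`; `R/(h) ≅ A`)
  have hmem : algebraMap R (AdicCompletion (maximalIdeal R) R) h ∈ maximalIdeal (AdicCompletion (maximalIdeal R) R) := by
    have h1 : algebraMap R (AdicCompletion (maximalIdeal R) R) h ∈ Ideal.span (Set.range (x ∘ Fin.succ)) :=
      Ideal.pow_le_self (Nat.pos_iff_ne_zero.mp hm) hhP
    refine hx ▸ Ideal.span_mono ?_ h1
    rintro _ ⟨k, rfl⟩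
    exact ⟨k.succ, rfl⟩
  haveI : Nontrivial (AdicCompletion (maximalIdeal R) R ⧸
      Ideal.span {algebraMap R (AdicCompletion (maximalIdeal R) R) h}) :=
    Ideal.Quotient.nontrivial_iff.mpr fun H =>
      (IsLocalRing.mem_maximalIdeal _).mp hmem (Ideal.span_singleton_eq_top.mp H)
  haveI : IsLocalRing (AdicCompletion (maximalIdeal R) R ⧸
      Ideal.span {algebraMap R (AdicCompletion (maximalIdeal R) R) h}) :=
    IsLocalRing.of_surjective' (Ideal.Quotient.mk _) Ideal.Quotient.mk_surjective
  haveI : Nontrivial (R ⧸ Ideal.span {h}) := e.symm.toEquiv.nontrivial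
  haveI : IsLocalRing (R ⧸ Ideal.span {h}) :=
    IsLocalRing.of_surjective' (Ideal.Quotient.mk _) Ideal.Quotient.mk_surjective
  -- H7 in r.s.p. form on `R̂`
  have H7 := not_isIsolatedInHSMaxLocus_closedPoint_of_rsop_arc hd' x hx hm hhP hh2 hN
  -- transport along `Â ≅ R̂/(h)`
  obtain ⟨E⟩ := nonempty_ringEquiv_adicCompletion_quotient_span h e
  intro hiso
  exact H7 (Moving.isIsolatedInHSMaxLocus_spec_of_iso
    (A := CommRingCat.of (AdicCompletion (maximalIdeal A) A))
    (B := CommRingCat.of (AdicCompletion (maximalIdeal R) R ⧸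
      Ideal.span {algebraMap R (AdicCompletion (maximalIdeal R) R) h}))
    E.toCommRingCatIso N hiso)

/-- **H7∞ SOCKET in Cohen coordinates** — the output shape of H6(c)(d): `Ψ : κ⟦X₀, …, X_d⟧ ≃+* R̂`, translations
`c_k ∈ (X₀) + 𝔪²` (e.g. `Σ_{j ≥ 1} c_{kj} X₀^j`), and «`h ∈ (ŷ_k − c_k)_k^m R̂`» with `ŷ_k = Ψ X_k`; conclusion as in
`not_isIsolatedInHSMaxLocus_adicCompletion_of_translatedArc`. [OURS · L1 W4.2; AI-written]
[cite: CossartJannsenSaito2020, Def. 13.3] -/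
theorem not_isIsolatedInHSMaxLocus_adicCompletion_of_cohenTranslatedArc {R : Type u} [CommRing R]
    [IsRegularLocalRing R] {d : ℕ} (hd : ringKrullDim R = (d + 1 : ℕ)) {A : Type u} [CommRing A] [IsLocalRing A]
    [IsNoetherianRing A] {h : R} (e : A ≃+* R ⧸ Ideal.span {h}) {m : ℕ} (hm : 1 ≤ m)
    (hh : h ∉ maximalIdeal R ^ (m + 1)) {κ : Type u} [Field κ]
    (Ψ : MvPowerSeries (Fin (d + 1)) κ ≃+* AdicCompletion (maximalIdeal R) R)
    (c : Fin d → MvPowerSeries (Fin (d + 1)) κ)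
    (hc : ∀ k, c k ∈ Ideal.span {MvPowerSeries.X 0} ⊔ maximalIdeal (MvPowerSeries (Fin (d + 1)) κ) ^ 2)
    (hhP : algebraMap R (AdicCompletion (maximalIdeal R) R) h ∈
      Ideal.span (Set.range fun k : Fin d => Ψ (MvPowerSeries.X k.succ - c k)) ^ m)
    {N : ℕ} (hN : d ≤ N) :
    ¬ IsIsolatedInHSMaxLocus (Spec (CommRingCat.of (AdicCompletion (maximalIdeal A) A))) N
        (closedPoint (AdicCompletion (maximalIdeal A) A)) := by
  -- the translated variables are a regular system of parameters of `κ⟦X⟧`, hence of `R̂` along `Ψ`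
  haveI : IsRegularLocalRing (MvPowerSeries (Fin (d + 1)) κ) := (isRegularLocalRing_mvPowerSeries_fin κ (d + 1)).1
  let x' : Fin (d + 1) → MvPowerSeries (Fin (d + 1)) κ :=
    Fin.cons (MvPowerSeries.X 0) (fun k => MvPowerSeries.X k.succ - c k)
  have hx' : Ideal.span (Set.range x') = maximalIdeal _ :=
    span_range_cons_sub_eq_maximalIdeal MvPowerSeries.X (span_range_X_eq_maximalIdeal κ d) c hc
  have hx : Ideal.span (Set.range (Ψ ∘ x')) = maximalIdeal _ := span_range_comp_ringEquiv Ψ x' hx'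
  refine not_isIsolatedInHSMaxLocus_adicCompletion_of_translatedArc hd e hm hh (Ψ ∘ x') hx ?_ hN
  have htail : (Ψ ∘ x') ∘ Fin.succ = fun k : Fin d => Ψ (MvPowerSeries.X k.succ - c k) := by
    funext k; simp [x']
  rwa [htail]

/-! ## §5 The same in the currency of H4 (`σ : R ↠ 𝒪_{X,x}`, `ker σ = (h)`, `emb.dim R = d + 1`) -/

/-- From a hypersurface presentation `σ : R ↠ A`, `ker σ = (h)` (the output of H4,
`…IsoTailsEmbeddedStepStalk.exists_stalk_presentation`): `A ≃+* R/(h)`. [folklore] -/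
theorem nonempty_ringEquiv_quotient_span_of_surjective {R : Type u} [CommRing R] {A : Type u} [CommRing A]
    (σ : R →+* A) (hσ : Function.Surjective σ) {h : R} (hker : RingHom.ker σ = Ideal.span {h}) :
    Nonempty (A ≃+* R ⧸ Ideal.span {h}) :=
  ⟨((Ideal.quotEquivOfEq hker.symm).trans (RingHom.quotientKerEquivOfSurjective hσ)).symm⟩

/-- `emb.dim R = d + 1` ⟹ `dim R = d + 1` for a regular local ring (H4 states regularity through `spanFinrank`). [folklore] -/
theorem ringKrullDim_eq_of_spanFinrank_eq {R : Type u} [CommRing R] [IsRegularLocalRing R] {n : ℕ}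
    (hd : (maximalIdeal R).spanFinrank = n) : ringKrullDim R = (n : ℕ) := by
  have h := IsRegularLocalRing.spanFinrank_maximalIdeal (R := R)
  rw [hd] at h
  exact_mod_cast h.symm

/-- **H7∞ SOCKET, H4 currency**: as `not_isIsolatedInHSMaxLocus_adicCompletion_of_translatedArc`, with the hypersurface
stage given by a surjection `σ : R ↠ A` with `ker σ = (h)` and `emb.dim R = d + 1` (the shape delivered by
`EmbeddedStep.exists_stalk_presentation(_tower)`, `A = 𝒪_{X_n,x_n}`). [OURS · L1 W4.2; AI-written]
[cite: CossartJannsenSaito2020, Def. 13.3] -/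
theorem not_isIsolatedInHSMaxLocus_adicCompletion_of_translatedArc_of_surjective {R : Type u} [CommRing R]
    [IsRegularLocalRing R] {d : ℕ} (hd : (maximalIdeal R).spanFinrank = d + 1) {A : Type u} [CommRing A]
    [IsLocalRing A] [IsNoetherianRing A] (σ : R →+* A) (hσ : Function.Surjective σ) {h : R}
    (hker : RingHom.ker σ = Ideal.span {h}) {m : ℕ} (hm : 1 ≤ m) (hh : h ∉ maximalIdeal R ^ (m + 1))
    (x : Fin (d + 1) → AdicCompletion (maximalIdeal R) R)
    (hx : Ideal.span (Set.range x) = maximalIdeal (AdicCompletion (maximalIdeal R) R))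
    (hhP : algebraMap R (AdicCompletion (maximalIdeal R) R) h ∈ Ideal.span (Set.range (x ∘ Fin.succ)) ^ m)
    {N : ℕ} (hN : d ≤ N) :
    ¬ IsIsolatedInHSMaxLocus (Spec (CommRingCat.of (AdicCompletion (maximalIdeal A) A))) N
        (closedPoint (AdicCompletion (maximalIdeal A) A)) := by
  obtain ⟨e⟩ := nonempty_ringEquiv_quotient_span_of_surjective σ hσ hker
  exact not_isIsolatedInHSMaxLocus_adicCompletion_of_translatedArc (ringKrullDim_eq_of_spanFinrank_eq hd) e hm hh
    x hx hhP hN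

/-- **H7∞ SOCKET in Cohen coordinates, H4 currency** (`σ : R ↠ A`, `ker σ = (h)`, `emb.dim R = d + 1`;
`Ψ : κ⟦X₀, …, X_d⟧ ≃+* R̂`, `c_k ∈ (X₀) + 𝔪²`, `h ∈ (Ψ (X_{k+1} − c_k))_k^m R̂`). [OURS · L1 W4.2; AI-written]
[cite: CossartJannsenSaito2020, Def. 13.3] -/
theorem not_isIsolatedInHSMaxLocus_adicCompletion_of_cohenTranslatedArc_of_surjective {R : Type u} [CommRing R]
    [IsRegularLocalRing R] {d : ℕ} (hd : (maximalIdeal R).spanFinrank = d + 1) {A : Type u} [CommRing A]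
    [IsLocalRing A] [IsNoetherianRing A] (σ : R →+* A) (hσ : Function.Surjective σ) {h : R}
    (hker : RingHom.ker σ = Ideal.span {h}) {m : ℕ} (hm : 1 ≤ m) (hh : h ∉ maximalIdeal R ^ (m + 1))
    {κ : Type u} [Field κ] (Ψ : MvPowerSeries (Fin (d + 1)) κ ≃+* AdicCompletion (maximalIdeal R) R)
    (c : Fin d → MvPowerSeries (Fin (d + 1)) κ)
    (hc : ∀ k, c k ∈ Ideal.span {MvPowerSeries.X 0} ⊔ maximalIdeal (MvPowerSeries (Fin (d + 1)) κ) ^ 2)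
    (hhP : algebraMap R (AdicCompletion (maximalIdeal R) R) h ∈
      Ideal.span (Set.range fun k : Fin d => Ψ (MvPowerSeries.X k.succ - c k)) ^ m)
    {N : ℕ} (hN : d ≤ N) :
    ¬ IsIsolatedInHSMaxLocus (Spec (CommRingCat.of (AdicCompletion (maximalIdeal A) A))) N
        (closedPoint (AdicCompletion (maximalIdeal A) A)) := by
  obtain ⟨e⟩ := nonempty_ringEquiv_quotient_span_of_surjective σ hσ hker
  exact not_isIsolatedInHSMaxLocus_adicCompletion_of_cohenTranslatedArc (ringKrullDim_eq_of_spanFinrank_eq hd) e hm hh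
    Ψ c hc hhP hN

/-! ## §6 The same in the EXACT output shape of lead-1's `FormalFrame.mem_pow_of_frameTower` (H6 (c)(d)):
`ψ₀ h ∈ (X 1 − tSeries c₁, X 2 − tSeries c₂, X 3 − tSeries c₃)^m` in `κ⟦X₀, …, X₃⟧`, base frame `ψ₀ = Ψ⁻¹ ∘ (R → R̂)` -/

/-- `Σ_{k ≥ 1} f k · t^k` is a multiple of `t = X 0` (no constant term and only `t`-powers). [folklore] -/
theorem tSeries_mem_span_X_zero {κ : Type u} [Field κ] (f : ℕ → κ) :
    Cruxes.SigmaMaxModifications.IdeasL1C5.Series.tSeries f ∈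
      Ideal.span {(MvPowerSeries.X 0 : MvPowerSeries (Fin 4) κ)} := by
  rw [Ideal.mem_span_singleton, MvPowerSeries.X_dvd_iff]
  intro e he
  rw [Cruxes.SigmaMaxModifications.IdeasL1C5.Series.coeff_tSeries, if_neg]
  rintro ⟨-, h0⟩
  rw [he] at h0
  exact lt_irrefl 0 h0

/-- The three translated coordinates as a `Fin 3`-indexed family. [folklore] -/
theorem insert_eq_range_fin_three {S : Type u} (f : Fin 3 → S) :
    ({f 0, f 1, f 2} : Set S) = Set.range f := by
  ext z
  simp only [Set.mem_insert_iff, Set.mem_singleton_iff, Set.mem_range]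
  constructor
  · rintro (rfl | rfl | rfl)
    exacts [⟨0, rfl⟩, ⟨1, rfl⟩, ⟨2, rfl⟩]
  · rintro ⟨k, rfl⟩
    fin_cases k
    · exact Or.inl rfl
    · exact Or.inr (Or.inl rfl)
    · exact Or.inr (Or.inr rfl)

/-- **H7∞ SOCKET for the FRAME TOWER (the H∞ plug).** `R` regular local with `emb.dim R = 4` and a hypersurface presentation
`σ : R ↠ A`, `ker σ = (h)`, `h ∉ 𝔪^{m+1}`, `m ≥ 1` (H4 at the stage `x_{n₀}`); Cohen coordinates `Ψ : κ⟦X₀..X₃⟧ ≃+* R̂` and the base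
frame `ψ₀ : R → κ⟦X⟧` with `Ψ ∘ ψ₀ = (R → R̂)`; and the conclusion of `FormalFrame.mem_pow_of_frameTower`:
`ψ₀ h ∈ (X 1 − tSeries c₁, X 2 − tSeries c₂, X 3 − tSeries c₃)^m`. Then the closed point of `Spec Â` is NOT isolated in the
Hilbert–Samuel locus at any level `N ≥ 3` — contradicting H8 applied to an isolated stage. [OURS · L1 W4.2; AI-written]
[cite: CossartJannsenSaito2020, Def. 13.3] [cite: CossartPiltant2009, ch. 3 I.9] -/
theorem not_isIsolatedInHSMaxLocus_adicCompletion_of_frameTowerArc {R : Type u} [CommRing R] [IsRegularLocalRing R]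
    (hd : (maximalIdeal R).spanFinrank = 4) {A : Type u} [CommRing A] [IsLocalRing A] [IsNoetherianRing A]
    (σ : R →+* A) (hσ : Function.Surjective σ) {h : R} (hker : RingHom.ker σ = Ideal.span {h}) {m : ℕ} (hm : 1 ≤ m)
    (hh : h ∉ maximalIdeal R ^ (m + 1)) {κ : Type u} [Field κ]
    (Ψ : MvPowerSeries (Fin 4) κ ≃+* AdicCompletion (maximalIdeal R) R) (ψ₀ : R →+* MvPowerSeries (Fin 4) κ)
    (hψ₀ : ∀ r, Ψ (ψ₀ r) = algebraMap R (AdicCompletion (maximalIdeal R) R) r) (c : ℕ → Fin 4 → κ)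
    (hhP : ψ₀ h ∈ (Ideal.span ({MvPowerSeries.X 1 - Cruxes.SigmaMaxModifications.IdeasL1C5.Series.tSeries (fun k => c k 1),
        MvPowerSeries.X 2 - Cruxes.SigmaMaxModifications.IdeasL1C5.Series.tSeries (fun k => c k 2),
        MvPowerSeries.X 3 - Cruxes.SigmaMaxModifications.IdeasL1C5.Series.tSeries (fun k => c k 3)} :
        Set (MvPowerSeries (Fin 4) κ))) ^ m)
    {N : ℕ} (hN : 3 ≤ N) :
    ¬ IsIsolatedInHSMaxLocus (Spec (CommRingCat.of (AdicCompletion (maximalIdeal A) A))) N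
        (closedPoint (AdicCompletion (maximalIdeal A) A)) := by
  -- the translations `c'_k = Σ_{j≥1} c_{j,k+1} t^j ∈ (t)`
  let c' : Fin 3 → MvPowerSeries (Fin 4) κ :=
    fun k => Cruxes.SigmaMaxModifications.IdeasL1C5.Series.tSeries (fun j => c j k.succ)
  have hc' : ∀ k, c' k ∈ Ideal.span {MvPowerSeries.X 0} ⊔ maximalIdeal (MvPowerSeries (Fin 4) κ) ^ 2 := fun k =>
    Ideal.mem_sup_left (tSeries_mem_span_X_zero _)
  -- rewrite the three-element set as the range of `k ↦ X (k+1) − c'_k` and push through `Ψ`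
  have hset : ({MvPowerSeries.X 1 - Cruxes.SigmaMaxModifications.IdeasL1C5.Series.tSeries (fun k => c k 1),
        MvPowerSeries.X 2 - Cruxes.SigmaMaxModifications.IdeasL1C5.Series.tSeries (fun k => c k 2),
        MvPowerSeries.X 3 - Cruxes.SigmaMaxModifications.IdeasL1C5.Series.tSeries (fun k => c k 3)} :
        Set (MvPowerSeries (Fin 4) κ)) = Set.range (fun k : Fin 3 => MvPowerSeries.X k.succ - c' k) :=
    insert_eq_range_fin_three (fun k : Fin 3 => MvPowerSeries.X k.succ - c' k)
  rw [hset] at hhP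
  have hhP' : algebraMap R (AdicCompletion (maximalIdeal R) R) h ∈
      Ideal.span (Set.range fun k : Fin 3 => Ψ (MvPowerSeries.X k.succ - c' k)) ^ m := by
    have h1 := Ideal.mem_map_of_mem Ψ.toRingHom hhP
    rw [Ideal.map_pow, Ideal.map_span, ← Set.range_comp] at h1
    rw [← hψ₀ h]
    exact h1
  exact not_isIsolatedInHSMaxLocus_adicCompletion_of_cohenTranslatedArc_of_surjective (d := 3) hd σ hσ hker hm hh Ψ c'
    hc' hhP' hN

end Summit.ResolutionOfSingularities.ResolutionOfSingularities.Theorems.SigmaMaxModificationsCorridor3.IsoTailsHS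

end
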